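import Mathlib
import HarnessLib

/-!
# Venture HSemireg — the defect matrix of an (E1)-class on a two-differential pencil

HONEST FRAMING. Lean leaf for the computation cell `pub-hsemireg` (target seat t-5 gen 22; file of record
`run/shared/lean/pub/pub-hsemireg/target-g6/KAPPA-DISJ-t5g22.md` §2). Setting of `FibreTestDefectFormula` (t-5 g21)
with the frame written `(u₁,u₂,u₃) = (dp, dq, x)`: three odd gluing operators of a «reduced-point complex», the first
two square-zero (`dp·dp = 0`, `dq·dq = 0` — the «two differentials» of t-5 g21's bed alert, OMEGA-LAW-t5g21 §15.4),
and ONE class with odd potentials `(Vp, Vq, y)` subject to the six Killing relations (E1)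
`{x,y} = 0`, `{dp,Vp} = 0`, `{dq,Vq} = 0`, `{x,Vp} + {dp,y} = 0`, `{x,Vq} + {dq,y} = 0`, `{dp,Vq} + {dq,Vp} = 0`
(`{a,b} := ab + ba`). Curvatures: `S_ps := x·dp + dp·x`, `S_qs := x·dq + dq·x`, `S_pq := dp·dq + dq·dp`.
THIS FILE kernel-checks, in an arbitrary ring, the exact identities of KAPPA-DISJ-t5g22 §2.1–2.2: the coefficient
identities of `[u(w)², V(w)] = u(w)·{u(w),V(w)} - {u(w),V(w)}·u(w)` (so each needs only the Killing relations named in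
its statement), namely `[S_ps,Vp] = 0`, `[S_qs,Vq] = 0`, `[S_pq,Vp] = 0`, `[S_pq,Vq] = 0`, the cubic identity
`[S_pq,y] + [S_ps,Vq] + [S_qs,Vp] = 0`, `[x·x,Vp] + [S_ps,y] = 0`, `[x·x,y] = 0`, the square-zero identity
`[d,{d,z}] = 0`, and the (E2)-defect identity
`[dp,{x,Vq}] + [dq,{dp,y}] + [x,{dq,Vp}] = [S_ps,Vq] - [S_qs,Vp] - 3·[x,{dp,Vq}]`
(the left side is `Σ_l [u_l,B_l] = -3·X₀` for the class components `B₁ = {x,Vq}`, `B₂ = {dp,y}`, `B₃ = {dq,Vp}`).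
Consequence recorded in the file of record (NOT formalised: it is a statement modulo the tangent space `[𝔤,x]`):
modulo `T_x` the nine defects of the class are `diag(a, -b, 0)` with `a = [S_ps,Vq]`, `b = [S_qs,Vp]`, and
`X₀ ≡ (b - a)/3`. Nothing here proves the κ-law, (TAN-D) or (W³); no object is constructed; nothing here bears on
HC, HC_CM or HC_AV.
-/

namespace Summit.Ventures.HSemireg

/-- **Square-zero identity** (any ring): if `d·d = 0` then `[d, {d,z}] = [d·d, z] = 0`. [folklore] -/
theorem comm_anticomm_eq_zero_of_sq_zero {R : Type*} [Ring R] (d z : R) (hd : d * d = 0) :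
    d * (d * z + z * d) - (d * z + z * d) * d = 0 := by
  have key : d * (d * z + z * d) - (d * z + z * d) * d = (d * d) * z - z * (d * d) := by noncomm_ring
  rw [key, hd]; noncomm_ring

/-- **`[x·x, y] = 0` from `{x,y} = 0`** (any ring): `[x·x, y] = [x, {x,y}]`. [folklore] -/
theorem comm_sq_eq_zero_of_anticomm_eq_zero {R : Type*} [Ring R] (x y : R) (h : x * y + y * x = 0) :
    (x * x) * y - y * (x * x) = 0 := by
  have key : (x * x) * y - y * (x * x) = x * (x * y + y * x) - (x * y + y * x) * x := by noncomm_ring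
  rw [key, h]; noncomm_ring

/-- **Diagonal curvature identity `[S_ps, Vp] = 0`** (KAPPA-DISJ-t5g22 §2.1; the `w_s w_p²` coefficient of
`[u(w)²,V(w)] = 0`; any ring). Needs `dp·dp = 0`, `{dp,Vp} = 0` and `{x,Vp} + {dp,y} = 0`.
Certificate: `[S_ps,Vp] = [x,{dp,Vp}] + [dp,{x,Vp}+{dp,y}] - [dp·dp, y]`. [folklore] -/
theorem comm_curv_ps_Vp_eq_zero {R : Type*} [Ring R] (x dp y Vp : R) (hdd : dp * dp = 0)
    (hpp : dp * Vp + Vp * dp = 0) (hsp : x * Vp + Vp * x + (dp * y + y * dp) = 0) :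
    (x * dp + dp * x) * Vp - Vp * (x * dp + dp * x) = 0 := by
  have key : (x * dp + dp * x) * Vp - Vp * (x * dp + dp * x)
      = (x * (dp * Vp + Vp * dp) - (dp * Vp + Vp * dp) * x)
        + (dp * (x * Vp + Vp * x + (dp * y + y * dp)) - (x * Vp + Vp * x + (dp * y + y * dp)) * dp)
        - ((dp * dp) * y - y * (dp * dp)) := by
    noncomm_ring
  rw [key, hpp, hsp, hdd]; noncomm_ring

/-- **Mixed curvature identity `[S_pq, Vp] = 0`** (KAPPA-DISJ-t5g22 §2.1; the `w_p² w_q` coefficient; any ring).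
Needs `dp·dp = 0`, `{dp,Vp} = 0` and `{dp,Vq} + {dq,Vp} = 0`.
Certificate: `[S_pq,Vp] = [dp,{dp,Vq}+{dq,Vp}] + [dq,{dp,Vp}] - [dp·dp, Vq]`. [folklore] -/
theorem comm_curv_pq_Vp_eq_zero {R : Type*} [Ring R] (dp dq Vp Vq : R) (hdd : dp * dp = 0)
    (hpp : dp * Vp + Vp * dp = 0) (hpq : dp * Vq + Vq * dp + (dq * Vp + Vp * dq) = 0) :
    (dp * dq + dq * dp) * Vp - Vp * (dp * dq + dq * dp) = 0 := by
  have key : (dp * dq + dq * dp) * Vp - Vp * (dp * dq + dq * dp)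
      = (dp * (dp * Vq + Vq * dp + (dq * Vp + Vp * dq)) - (dp * Vq + Vq * dp + (dq * Vp + Vp * dq)) * dp)
        + (dq * (dp * Vp + Vp * dp) - (dp * Vp + Vp * dp) * dq)
        - ((dp * dp) * Vq - Vq * (dp * dp)) := by
    noncomm_ring
  rw [key, hpq, hpp, hdd]; noncomm_ring

/-- **The cubic identity `[S_pq, y] + [S_ps, Vq] + [S_qs, Vp] = 0`** (KAPPA-DISJ-t5g22 §2.1 / OMEGA-LAW-t5g21 §15.1;
the `w_s w_p w_q` coefficient of `[u(w)²,V(w)] = 0`; any ring; no square-zero hypothesis). Needs the three mixed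
Killing relations `{x,Vp}+{dp,y} = 0`, `{x,Vq}+{dq,y} = 0`, `{dp,Vq}+{dq,Vp} = 0`.
Certificate: `LHS = [x,{dp,Vq}+{dq,Vp}] + [dp,{x,Vq}+{dq,y}] + [dq,{x,Vp}+{dp,y}]`. [folklore] -/
theorem cubic_curvature_identity {R : Type*} [Ring R] (x dp dq y Vp Vq : R)
    (hsp : x * Vp + Vp * x + (dp * y + y * dp) = 0) (hsq : x * Vq + Vq * x + (dq * y + y * dq) = 0)
    (hpq : dp * Vq + Vq * dp + (dq * Vp + Vp * dq) = 0) :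
    ((dp * dq + dq * dp) * y - y * (dp * dq + dq * dp))
      + ((x * dp + dp * x) * Vq - Vq * (x * dp + dp * x))
      + ((x * dq + dq * x) * Vp - Vp * (x * dq + dq * x)) = 0 := by
  have key : ((dp * dq + dq * dp) * y - y * (dp * dq + dq * dp))
      + ((x * dp + dp * x) * Vq - Vq * (x * dp + dp * x))
      + ((x * dq + dq * x) * Vp - Vp * (x * dq + dq * x))
      = (x * (dp * Vq + Vq * dp + (dq * Vp + Vp * dq)) - (dp * Vq + Vq * dp + (dq * Vp + Vp * dq)) * x)
        + (dp * (x * Vq + Vq * x + (dq * y + y * dq)) - (x * Vq + Vq * x + (dq * y + y * dq)) * dp)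
        + (dq * (x * Vp + Vp * x + (dp * y + y * dp)) - (x * Vp + Vp * x + (dp * y + y * dp)) * dq) := by
    noncomm_ring
  rw [key, hpq, hsq, hsp]; noncomm_ring

/-- **`[x·x, Vp] + [S_ps, y] = 0`** (KAPPA-DISJ-t5g22 §2.1; the `w_s² w_p` coefficient; any ring). Needs
`{x,y} = 0` and `{x,Vp}+{dp,y} = 0`. Certificate: `LHS = [x,{x,Vp}+{dp,y}] + [dp,{x,y}]`. [folklore] -/
theorem comm_sq_Vp_add_comm_curv_ps_y_eq_zero {R : Type*} [Ring R] (x dp y Vp : R)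
    (hss : x * y + y * x = 0) (hsp : x * Vp + Vp * x + (dp * y + y * dp) = 0) :
    ((x * x) * Vp - Vp * (x * x)) + ((x * dp + dp * x) * y - y * (x * dp + dp * x)) = 0 := by
  have key : ((x * x) * Vp - Vp * (x * x)) + ((x * dp + dp * x) * y - y * (x * dp + dp * x))
      = (x * (x * Vp + Vp * x + (dp * y + y * dp)) - (x * Vp + Vp * x + (dp * y + y * dp)) * x)
        + (dp * (x * y + y * x) - (x * y + y * x) * dp) := by
    noncomm_ring
  rw [key, hsp, hss]; noncomm_ring

/-- **The (E2)-defect of a class on a two-differential pencil** (KAPPA-DISJ-t5g22 §2.2 (I1); any ring; no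
square-zero hypothesis is needed for this identity). With the class components `B₁ = {x,Vq}`, `B₂ = {dp,y}`,
`B₃ = {dq,Vp}` (frame `(dp,dq,x)`), the (E2)-defect `Σ_l [u_l,B_l] = [dp,B₁] + [dq,B₂] + [x,B₃]` equals
`[S_ps,Vq] - [S_qs,Vp] - 3·[x,{dp,Vq}]` as soon as the two Killing relations `{x,Vp}+{dp,y} = 0` and
`{dp,Vq}+{dq,Vp} = 0` hold. Certificate: `LHS - RHS = 2·[x, {dp,Vq}+{dq,Vp}] + [dq, {x,Vp}+{dp,y}]`.
So a CLOSED class (Σ_l [u_l,B_l] = 0) has `[S_ps,Vq] ≡ [S_qs,Vp]` modulo `[x,𝔤] ⊂ T_x`. [folklore] -/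
theorem divergence_eq_curvature_defects {R : Type*} [Ring R] (x dp dq y Vp Vq : R)
    (hsp : x * Vp + Vp * x + (dp * y + y * dp) = 0) (hpq : dp * Vq + Vq * dp + (dq * Vp + Vp * dq) = 0) :
    (dp * (x * Vq + Vq * x) - (x * Vq + Vq * x) * dp)
      + (dq * (dp * y + y * dp) - (dp * y + y * dp) * dq)
      + (x * (dq * Vp + Vp * dq) - (dq * Vp + Vp * dq) * x)
      = ((x * dp + dp * x) * Vq - Vq * (x * dp + dp * x))
        - ((x * dq + dq * x) * Vp - Vp * (x * dq + dq * x))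
        - 3 * (x * (dp * Vq + Vq * dp) - (dp * Vq + Vq * dp) * x) := by
  have key : (dp * (x * Vq + Vq * x) - (x * Vq + Vq * x) * dp)
      + (dq * (dp * y + y * dp) - (dp * y + y * dp) * dq)
      + (x * (dq * Vp + Vp * dq) - (dq * Vp + Vp * dq) * x)
      - (((x * dp + dp * x) * Vq - Vq * (x * dp + dp * x))
        - ((x * dq + dq * x) * Vp - Vp * (x * dq + dq * x))
        - 3 * (x * (dp * Vq + Vq * dp) - (dp * Vq + Vq * dp) * x))
      = 2 * (x * (dp * Vq + Vq * dp + (dq * Vp + Vp * dq)) - (dp * Vq + Vq * dp + (dq * Vp + Vp * dq)) * x)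
        + (dq * (x * Vp + Vp * x + (dp * y + y * dp)) - (x * Vp + Vp * x + (dp * y + y * dp)) * dq) := by
    noncomm_ring
  rw [hpq, hsp] at key
  have : (dp * (x * Vq + Vq * x) - (x * Vq + Vq * x) * dp)
      + (dq * (dp * y + y * dp) - (dp * y + y * dp) * dq)
      + (x * (dq * Vp + Vp * dq) - (dq * Vp + Vp * dq) * x)
      - (((x * dp + dp * x) * Vq - Vq * (x * dp + dp * x))
        - ((x * dq + dq * x) * Vp - Vp * (x * dq + dq * x))
        - 3 * (x * (dp * Vq + Vq * dp) - (dp * Vq + Vq * dp) * x)) = 0 := by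
    rw [key]; noncomm_ring
  exact sub_eq_zero.mp this

/-- **The off-diagonal defects vanish** (KAPPA-DISJ-t5g22 §2.2; any ring): on a two-differential pencil the
defects `[dp, B₂] = [dp,{dp,y}]` and `[dq, B₁] = [dq,{x,Vq}] = -[dq,{dq,y}]` of an (E1)-class vanish identically —
the first by `dp·dp = 0`, the second by `dq·dq = 0` and the Killing relation `{x,Vq}+{dq,y} = 0`.
Certificate for the second: `[dq,{x,Vq}] = [dq, {x,Vq}+{dq,y}] - [dq·dq, y]`. [folklore] -/
theorem offdiag_defect_dq_B1_eq_zero {R : Type*} [Ring R] (x dq y Vq : R) (hdd : dq * dq = 0)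
    (hsq : x * Vq + Vq * x + (dq * y + y * dq) = 0) :
    dq * (x * Vq + Vq * x) - (x * Vq + Vq * x) * dq = 0 := by
  have key : dq * (x * Vq + Vq * x) - (x * Vq + Vq * x) * dq
      = (dq * (x * Vq + Vq * x + (dq * y + y * dq)) - (x * Vq + Vq * x + (dq * y + y * dq)) * dq)
        - ((dq * dq) * y - y * (dq * dq)) := by
    noncomm_ring
  rw [key, hsq, hdd]; noncomm_ring

end Summit.Ventures.HSemireg
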